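import Summits.FinalStateConjecture.FinalStateConjecture.Theorems.PhotonSphereChannelsTameCensorshipImmortalObservers
import Literature.Geometry.Lorentzian.SpacetimeReverse
import Literature.Geometry.Lorentzian.KerrHyperboloidalFlux
import Literature.Geometry.Lorentzian.KerrWaveEnergy
import Literature.Geometry.Lorentzian.KerrSchildCoord
import Literature.Geometry.Lorentzian.KerrDataProofs
import Literature.Geometry.Lorentzian.ChartCalculus
import Literature.Geometry.Lorentzian.CausalityProofs
import Literature.Geometry.Lorentzian.BoostedKerrCausalLegs
import Literature.Geometry.Lorentzian.LandauLifshitzFluxLaw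
import Summits.FinalStateConjecture.FinalStateConjecture.Theorems.KerrShieldedDataExist.Negative.BentSliceConormal

/-!
# Route PhotonSphereChannels · crux `TameCensorship` (stmt-FinalStateConjecture-17431) · line `Sketch`, skeleton v7 ·
# STUB 19, auxiliary file: Kerr–Schild bounds, continuity of `g(T, dΨ V)`, sign constancy, coordinates

Helpers for the orientation dichotomy `stub_orientationDichotomy` (file `…OrientationDichotomy.lean`, lead c3,
2026-08-17; `--supports stmt-FinalStateConjecture-17431`): the Kerr–Schild time vector `V = ∂₀ − 2H ℓ♯` is
uniformly timelike for the (boosted) background form, `g(V, V) = −1 − 2H ≤ −1`, and bounded, `‖V‖ ≤ 5`, on the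
exterior `{r > max r₊ 0}` (`H ≤ M/r ≤ 1`, `‖ℓ♯‖ = √2`); the boosted field `x ↦ Λ V(Λ⁻¹(x − c))` is smooth; for a
smooth chart map `Ψ : U → 𝓢` and a smooth `E4`-valued field `V` the orientation functional
`x ↦ g_{Ψ x}(T(Ψ x), dΨ_x(V x))` is continuous (Mathlib `ContMDiff.clm_bundle_apply₂` at regularity `0`); and a
continuous real function without zeros has constant sign on a preconnected set.

References: B. O'Neill, *Semi-Riemannian Geometry* (1983), Ch. 3, Def. 3.1; Ch. 5, Lemma 5.26–5.32; M. Visser,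
arXiv:0706.0622, (32)–(35); Dafermos–Rodnianski arXiv:0811.0354, §5.1.
-/

set_option linter.dupNamespace false

noncomputable section

open Literature.Geometry.Lorentzian Set Filter TopologicalSpace Bundle
open scoped Manifold ContDiff Topology ENNReal NNReal

namespace Summit.FinalStateConjecture.FinalStateConjecture.Theorems.PhotonSphereChannels.TameCensorshipUnwind

open Summit.FinalStateConjecture.FinalStateConjecture.Theorems.PhotonSphereChannels.TameCensorshipCrush
  (enorm_deviation_le_truncDeviationCk)

/-! ## Kerr–Schild algebra: the time vector is uniformly timelike and bounded on the exterior -/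

/-- The Kerr–Schild null vector `ℓ♯ = (−1, ℓ⃗)`, `|ℓ⃗| = 1`, has Euclidean norm `√2 ≤ 2` wherever `r > 0`.
[cite: arXiv07060622, (34)–(35)] -/
theorem norm_nullVector_le_two {a : ℝ} {x : E4} (hx : 0 < Kerr.radius a x) : ‖Kerr.nullVector a x‖ ≤ 2 := by
  have hsum := Kerr.sum_sq_nullCovectorFun hx
  have h2 : ‖Kerr.nullVector a x‖ ^ 2 = 2 := by
    rw [EuclideanSpace.real_norm_sq_eq, Fin.sum_univ_four, Kerr.nullVector_apply_zero,
      Kerr.nullVector_apply_one, Kerr.nullVector_apply_two, Kerr.nullVector_apply_three]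
    nlinarith [hsum]
  nlinarith [norm_nonneg (Kerr.nullVector a x), h2]

/-- On the Kerr exterior `{r > max r₊ 0}` with `M ≥ 0` one has `H ≤ 1` (`H ≤ M/r`, `r > r₊ ≥ M`).
[cite: arXiv07060622, (33)] -/
theorem scalarH_le_one_of_mem_exterior {M a : ℝ} (hM : 0 ≤ M) {x : E4} (hx : x ∈ Kerr.exterior M a) :
    Kerr.scalarH M a x ≤ 1 := by
  have hr : 0 < Kerr.radius a x := Kerr.radius_pos_of_mem_region hx
  have hx' := Kerr.mem_exterior.mp hx
  have hrp : M ≤ Kerr.rPlus M a := by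
    unfold Kerr.rPlus
    linarith [Real.sqrt_nonneg (M ^ 2 - a ^ 2)]
  have hMr : M ≤ Kerr.radius a x := by
    have := le_max_left (Kerr.rPlus M a) 0
    linarith
  calc Kerr.scalarH M a x ≤ M / Kerr.radius a x := Kerr.scalarH_le_div hM a hr
    _ ≤ 1 := (div_le_one hr).mpr hMr

/-- **The Kerr–Schild time vector is bounded on the exterior**: `‖V_{M,a}(x)‖ ≤ 5` for `M ≥ 0`,
`x ∈ {r > max r₊ 0}` (`V = ∂₀ − 2H ℓ♯`, `0 ≤ H ≤ 1`, `‖ℓ♯‖ ≤ 2`). [cite: arXiv08110354, §5.1] -/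
theorem norm_timeVector_le {M a : ℝ} (hM : 0 ≤ M) {x : E4} (hx : x ∈ Kerr.exterior M a) :
    ‖Kerr.timeVector M a x‖ ≤ 5 := by
  have hr : 0 < Kerr.radius a x := Kerr.radius_pos_of_mem_region hx
  have hH0 := Kerr.scalarH_nonneg hM a x
  have hH1 := scalarH_le_one_of_mem_exterior hM hx
  have hl := norm_nullVector_le_two hr
  have he : ‖E4.basisVector 0‖ = 1 := by simp [E4.basisVector]
  unfold Kerr.timeVector
  calc ‖E4.basisVector 0 - (2 * Kerr.scalarH M a x) • Kerr.nullVector a x‖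
      ≤ ‖E4.basisVector 0‖ + ‖(2 * Kerr.scalarH M a x) • Kerr.nullVector a x‖ := norm_sub_le _ _
    _ = 1 + 2 * Kerr.scalarH M a x * ‖Kerr.nullVector a x‖ := by
        rw [he, norm_smul, Real.norm_eq_abs, abs_of_nonneg (by positivity)]
    _ ≤ 1 + 2 * 1 * 2 := by gcongr
    _ = 5 := by norm_num

/-! ## The boosted background: Poincaré bookkeeping, timelikeness and boundedness of `Λ V` -/

/-- `Λ⁻¹((Λ y + c) − c) = y`. [folklore] -/
theorem poincareInv_boost_add (Λ : lorentzGroup) (c y : E4) :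
    poincareInv Λ c ((Λ : E4 ≃L[ℝ] E4) y + c) = y := by
  simp [poincareInv]

/-- **The boosted Kerr–Schild time vector is uniformly timelike for the background form**:
`g_B(x)(ΛV, ΛV) = g_{M,a}(Λ⁻¹(x − c))(V, V) = −1 − 2H ≤ −1` on the boosted exterior (`M ≥ 0`).
[cite: arXiv08110354, §5.1] -/
theorem bilin_boostedTimeVector_le {Λ : lorentzGroup} {c : E4} {M a : ℝ} (hM : 0 ≤ M)
    (x : (boostedKerrBackground Λ c M a).domain) :
    (boostedKerrBackground Λ c M a).bilin x.1
        ((Λ : E4 ≃L[ℝ] E4) (Kerr.timeVector M a (poincareInv Λ c x.1)))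
        ((Λ : E4 ≃L[ℝ] E4) (Kerr.timeVector M a (poincareInv Λ c x.1))) ≤ -1 := by
  have hx : poincareInv Λ c x.1 ∈ Kerr.exterior M a := mem_boostedKerrExterior.mp x.2
  have hr : 0 < Kerr.radius a (poincareInv Λ c x.1) := Kerr.radius_pos_of_mem_region hx
  show boostedKerrBilin Λ c M a x.1 _ _ ≤ -1
  rw [boostedKerrBilin_apply, ContinuousLinearEquiv.symm_apply_apply,
    Kerr.bilin_timeVector_timeVector hr]
  linarith [Kerr.scalarH_nonneg hM a (poincareInv Λ c x.1)]

/-- `‖Λ V‖ ≤ 5 ‖Λ‖` on the boosted exterior (`M ≥ 0`). [folklore] -/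
theorem norm_boostedTimeVector_le {Λ : lorentzGroup} {c : E4} {M a : ℝ} (hM : 0 ≤ M)
    (x : (boostedKerrBackground Λ c M a).domain) :
    ‖(Λ : E4 ≃L[ℝ] E4) (Kerr.timeVector M a (poincareInv Λ c x.1))‖ ≤
      ‖((Λ : E4 ≃L[ℝ] E4) : E4 →L[ℝ] E4)‖ * 5 := by
  have hx : poincareInv Λ c x.1 ∈ Kerr.exterior M a := mem_boostedKerrExterior.mp x.2
  calc ‖(Λ : E4 ≃L[ℝ] E4) (Kerr.timeVector M a (poincareInv Λ c x.1))‖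
      ≤ ‖((Λ : E4 ≃L[ℝ] E4) : E4 →L[ℝ] E4)‖ * ‖Kerr.timeVector M a (poincareInv Λ c x.1)‖ :=
        ((Λ : E4 ≃L[ℝ] E4) : E4 →L[ℝ] E4).le_opNorm _
    _ ≤ ‖((Λ : E4 ≃L[ℝ] E4) : E4 →L[ℝ] E4)‖ * 5 := by
        gcongr
        exact norm_timeVector_le hM hx

/-- The boosted Kerr–Schild time vector field `x ↦ Λ V_{M,a}(Λ⁻¹(x − c))` is smooth on the boosted exterior
(`Kerr.contDiffAt_timeVector`; the Poincaré map is affine). [folklore] -/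
theorem contDiffAt_boostedTimeVector {Λ : lorentzGroup} {c : E4} {M a : ℝ} {z : E4}
    (hz : poincareInv Λ c z ∈ Kerr.exterior M a) :
    ContDiffAt ℝ ∞ (fun z : E4 => (Λ : E4 ≃L[ℝ] E4) (Kerr.timeVector M a (poincareInv Λ c z))) z := by
  have hr : 0 < Kerr.radius a (poincareInv Λ c z) := Kerr.radius_pos_of_mem_region hz
  have hp : ContDiff ℝ ∞ (poincareInv Λ c) := by
    unfold poincareInv
    exact (Λ : E4 ≃L[ℝ] E4).symm.contDiff.comp (contDiff_id.sub contDiff_const)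
  exact (Λ : E4 ≃L[ℝ] E4).contDiff.contDiffAt.comp z
    ((Kerr.contDiffAt_timeVector M a hr).comp z hp.contDiffAt)

/-! ## Continuity of `g(T, dΨ V)` on a chart domain -/

/-- **STUB (registered helper) — continuity of the orientation functional.** For a smooth chart map `Ψ : U → 𝓢` on an open `U ⊆ E4` and a
smooth `E4`-valued field `V` on `U`, the function `x ↦ g_{Ψ x}(T(Ψ x), dΨ_x(V x))` (`T` the orienting field of `𝓢`)
is continuous: the metric is a continuous section of the bundle of bilinear forms, `x ↦ (Ψ x, T(Ψ x))` and
`x ↦ (Ψ x, dΨ_x(V x))` are continuous into `T𝓢` (orienting field smooth; tangent map of `Ψ` applied to the smooth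
section `x ↦ (x, V x)` of `TU`, `OpensChart.contMDiffAt_section_iff`), and Mathlib's `ContMDiff.clm_bundle_apply₂`
at regularity `0` evaluates. [cite: ONeillSemiRiemannian1983, Ch. 3, Def. 3.1] -/
theorem stub_continuous_val_vectorField_mfderiv :
    ∀ (𝓢 : Spacetime.{0} 4) (U : TopologicalSpace.Opens E4) (Ψ : U → 𝓢.carrier),
    ContMDiff 𝓘(ℝ, E4) (𝓡 4) ∞ Ψ → ∀ (V : U → E4), (∀ x : U, ContMDiffAt 𝓘(ℝ, E4) 𝓘(ℝ, E4) ∞ V x) →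
    Continuous fun x : U => 𝓢.metric.val (Ψ x) (𝓢.timeOrientation.vectorField (Ψ x))
      (mfderiv 𝓘(ℝ, E4) (𝓡 4) Ψ x (V x)) := by
  intro 𝓢 U Ψ hΨ V hV
  have h1n : (1 : ℕ∞ω) ≤ ((⊤ : ℕ∞) : ℕ∞ω) := WithTop.coe_le_coe.mpr le_top
  -- the section `x ↦ (x, V x)` of `TU` is smooth, hence continuous
  have hsec : ContMDiff 𝓘(ℝ, E4) 𝓘(ℝ, E4).tangent ∞
      (fun x : U => (⟨x, V x⟩ : TangentBundle 𝓘(ℝ, E4) U)) :=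
    fun x => (OpensChart.contMDiffAt_section_iff x (fun y => V y)).2 (hV x)
  -- the push-forward `x ↦ (Ψ x, dΨ (V x))` is continuous into `T𝓢`
  have hW : Continuous (fun x : U =>
      (⟨Ψ x, mfderiv 𝓘(ℝ, E4) (𝓡 4) Ψ x (V x)⟩ : TangentBundle (𝓡 4) 𝓢.carrier)) :=
    (hΨ.continuous_tangentMap h1n).comp hsec.continuous
  -- the orienting field along `Ψ` is continuous into `T𝓢`
  have hT : Continuous (fun x : U =>
      (⟨Ψ x, 𝓢.timeOrientation.vectorField (Ψ x)⟩ : TangentBundle (𝓡 4) 𝓢.carrier)) :=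
    (contMDiff_zero_iff.mp (𝓢.timeOrientation.contMDiff.of_le bot_le)).comp hΨ.continuous
  -- evaluate the metric (a `C⁰` section of the bundle of bilinear forms) on the two lifts
  have hg0 : ContMDiff (𝓡 4) ((𝓡 4).prod 𝓘(ℝ, E4 →L[ℝ] E4 →L[ℝ] ℝ)) 0
      (fun b ↦ TotalSpace.mk' (E4 →L[ℝ] E4 →L[ℝ] ℝ) b (𝓢.metric.val b)) :=
    𝓢.metric.contMDiff.of_le bot_le
  have hc0 : ContMDiff 𝓘(ℝ, E4) (𝓡 4) 0 Ψ := hΨ.of_le bot_le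
  have hT0 : ContMDiff 𝓘(ℝ, E4) (𝓡 4).tangent 0 (fun x : U =>
      (⟨Ψ x, 𝓢.timeOrientation.vectorField (Ψ x)⟩ : TangentBundle (𝓡 4) 𝓢.carrier)) :=
    contMDiff_zero_iff.mpr hT
  have hW0 : ContMDiff 𝓘(ℝ, E4) (𝓡 4).tangent 0 (fun x : U =>
      (⟨Ψ x, mfderiv 𝓘(ℝ, E4) (𝓡 4) Ψ x (V x)⟩ : TangentBundle (𝓡 4) 𝓢.carrier)) :=
    contMDiff_zero_iff.mpr hW
  have h : ContMDiff 𝓘(ℝ, E4) ((𝓡 4).prod 𝓘(ℝ, ℝ)) 0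
      (fun x : U ↦ TotalSpace.mk' ℝ (E := Bundle.Trivial 𝓢.carrier ℝ) (Ψ x)
        (𝓢.metric.val (Ψ x) (𝓢.timeOrientation.vectorField (Ψ x))
          (mfderiv 𝓘(ℝ, E4) (𝓡 4) Ψ x (V x)))) :=
    (hg0.comp hc0).clm_bundle_apply₂ (F₁ := E4) (F₂ := E4) hT0 hW0
  rw [← contMDiff_zero_iff (I := 𝓘(ℝ, E4)) (I' := 𝓘(ℝ, ℝ))]
  intro x
  have hx := h x
  simp only [contMDiffAt_totalSpace] at hx
  exact hx.2

/-! ## Sign constancy on preconnected sets -/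

/-- A continuous real function without zeros on a preconnected set has constant sign there. [folklore] -/
theorem neg_iff_neg_of_isPreconnected {Y : Type*} [TopologicalSpace Y] {S : Set Y} (hS : IsPreconnected S)
    {f : Y → ℝ} (hf : ContinuousOn f S) (hne : ∀ p ∈ S, f p ≠ 0) {p q : Y} (hp : p ∈ S) (hq : q ∈ S) :
    f p < 0 ↔ f q < 0 := by
  constructor
  · intro hfp
    by_contra hfq
    have hfq' : 0 < f q := lt_of_le_of_ne (not_lt.mp hfq) (hne q hq).symm
    obtain ⟨z, hz, hfz⟩ := hS.intermediate_value hp hq hf ⟨hfp.le, hfq'.le⟩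
    exact hne z hz hfz
  · intro hfq
    by_contra hfp
    have hfp' : 0 < f p := lt_of_le_of_ne (not_lt.mp hfp) (hne p hp).symm
    obtain ⟨z, hz, hfz⟩ := hS.intermediate_value hq hp hf ⟨hfq.le, hfp'.le⟩
    exact hne z hz hfz

/-! Coordinate bookkeeping reused from the tree: `LandauLifshitz.ofTimeSpace_eq_add_smul` (`(t, y) = (0, y) + t ∂₀`),
`KerrShieldedDataExist.Negative.radius_ofTimeSpace` (the Kerr–Schild radius does not see `t*`),
`BoostedKerrLegs.apply_poincareInv_add` (`Λ (Λ⁻¹(x − c)) + c = x`). -/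

end Summit.FinalStateConjecture.FinalStateConjecture.Theorems.PhotonSphereChannels.TameCensorshipUnwind

end
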